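import Mathlib
import Literature.Barriers.ValiantsHypothesis.CKRST20NaturalProofsExist
import Summits.ValiantsHypothesis.ValiantsHypothesis.Theorems.BarrierLeverNaturalProofsSeparateVNPSignSliceCoeffs
import Summits.ValiantsHypothesis.ValiantsHypothesis.Theorems.BarrierLeverNaturalProofsSeparateVNPSignSliceZeroPatterns
import Summits.ValiantsHypothesis.ValiantsHypothesis.Theorems.BarrierLeverNaturalProofsSeparateVNPSignSliceHittingPoint
import Summits.ValiantsHypothesis.ValiantsHypothesis.Theorems.BarrierLeverNaturalProofsSeparateVNPSignSliceHitGen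
import Summits.ValiantsHypothesis.ValiantsHypothesis.Theorems.BarrierLeverNaturalProofsSeparateVNPSignSliceVNPParam
import HarnessLib

/-!
# Item `BarrierLever.NaturalProofsSeparateVNP` (stmt-ValiantsHypothesis-18972), SIGN SLICE —
# part 14: ONE integer point hits every sign polynomial of CKRST's `VNP` slice (Boolean sums)

The `VNP` analogue of part 9, for CKRST's slice `vnpSlice ℂ n d t` (degree `≤ d`, `f = boolSum g`
with `g ∈ ℂ[x ⊕ w]`, `|w| = m ≤ t`, of size and degree `≤ t`; `CKRST20NaturalProofsExist.lean`): by the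
parametrisation of Boolean sums (part 13) and the zero-pattern count (part 1), for each `m ≤ t` at most
`(4 t C(n+d,d) + 1)^(9376 (n+3t+4)^21)` sign polynomials arise, hence at most `t + 1` times that in
all, and a Schwartz–Zippel union bound over `[1, B]^n`, `B = hitBoundVNP n d t`, leaves a point.

* `VNPHit.hitBoundVNP n d t = (t+1) (4 t C(n+d,d) + 1)^(9376 (n+3t+4)^21) · d + 1`;
* `VNPHit.exists_hitting_point` — for `n, t ≥ 1` some `a ∈ [1, hitBoundVNP n d t]^n` has
  `f(a) ≠ 0` for every nonzero `f ∈ vnpSlice ℂ n d t ∩ signCoeffSlice ℂ n`.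

References: [ChatterjeeKumarRamyaSaptharishiTengse2020] §5 (Thm. 1.3: "hitting sets for `VNP`");
[RonyaiBabaiGanapathy2001] Thm. 1.1.
-/

-- layout Summits/ValiantsHypothesis/ValiantsHypothesis forces the duplicated namespace component
set_option linter.dupNamespace false

noncomputable section

namespace Summit.ValiantsHypothesis.ValiantsHypothesis.Theorems.BarrierLever.NaturalProofsSeparateVNP

open Literature.Barriers.ValiantsHypothesis Literature.Computability.AlgebraicComplexity MvPolynomial

namespace VNPHit

/-- The coordinate bound of the hitting point for the `VNP` slice. [cite: ChatterjeeKumarRamyaSaptharishiTengse2020, §5] -/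
def hitBoundVNP (n d t : ℕ) : ℕ :=
  (t + 1) * (4 * t * (n + d).choose d + 1) ^ (9376 * (n + t + t + t + 4) ^ 21) * d + 1

/-- `hitBoundVNP n d t ≥ 1`. [folklore] -/
theorem one_le_hitBoundVNP (n d t : ℕ) : 1 ≤ hitBoundVNP n d t := Nat.le_add_left 1 _

/-- **One point hits every sign polynomial of the `VNP` slice.** For `n, t ≥ 1` there is
`a ∈ [1, hitBoundVNP n d t]^n` with `f(a) ≠ 0` for every nonzero `f ∈ vnpSlice ℂ n d t` with
coefficients in `{0, 1, -1}`. [cite: ChatterjeeKumarRamyaSaptharishiTengse2020, §5] -/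
theorem exists_hitting_point (n d t : ℕ) (hn : 1 ≤ n) (ht : 1 ≤ t) :
    ∃ a : Fin n → ℕ, (∀ i, 1 ≤ a i ∧ a i ≤ hitBoundVNP n d t) ∧
      ∀ f ∈ vnpSlice ℂ n d t, f ∈ signCoeffSlice ℂ n → f ≠ 0 →
        eval (fun i => (a i : ℂ)) f ≠ 0 := by
  classical
  letI : Fintype (monomialsDegLE n d) := HitGen.monFintype n d
  -- one parametrisation per number `m` of Boolean variables
  have hpar := fun m : ℕ => VNPParam.exists_parametrization_boolSum n m t d hn ht
  choose p G hp hdeg hG using hpar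
  set N := Fintype.card (monomialsDegLE n d) with hN
  have hNc : N = (n + d).choose d := HitGen.card_monomialsDegLE n d
  -- the finite class to be hit
  let vecs : Finset (monomialsDegLE n d → ℤ) := Fintype.piFinset fun _ => ({0, 1, -1} : Finset ℤ)
  let T : Finset (MvPolynomial (Fin n) ℂ) :=
    (vecs.image Coeffs.poly).filter (fun f => f ∈ vnpSlice ℂ n d t ∧ f ≠ 0)
  let Tm : ℕ → Finset (MvPolynomial (Fin n) ℂ) := fun m =>
    T.filter (fun f => ∃ g : MvPolynomial (Fin n ⊕ Fin m) ℂ,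
      complexity g ≤ t ∧ g.totalDegree ≤ t ∧ f = boolSum g)
  have hvecs : ∀ e, e ∈ vecs ↔ ∀ μ, e μ = 0 ∨ e μ = 1 ∨ e μ = -1 := by
    intro e; simp [vecs, Fintype.mem_piFinset]
  have hTmem : ∀ f ∈ vnpSlice ℂ n d t, f ∈ signCoeffSlice ℂ n → f ≠ 0 → f ∈ T := by
    intro f hf hs h0
    refine Finset.mem_filter.mpr ⟨Finset.mem_image.mpr ⟨Coeffs.sgnVec (monomialsDegLE n d) f,
      (hvecs _).mpr (Coeffs.sgnVec_mem f),
      Coeffs.poly_sgnVec_of_totalDegree_le (HitGen.mem_of_degree_le n d) hs hf.1⟩, hf, h0⟩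
  have hTvec : ∀ f ∈ T, ∃ e : monomialsDegLE n d → ℤ,
      (∀ μ, e μ = 0 ∨ e μ = 1 ∨ e μ = -1) ∧ f = Coeffs.poly e := by
    intro f hf
    obtain ⟨e, he, rfl⟩ := Finset.mem_image.mp (Finset.mem_filter.mp hf).1
    exact ⟨e, (hvecs e).mp he, rfl⟩
  have hTsub : T ⊆ (Finset.range (t + 1)).biUnion Tm := by
    intro f hf
    obtain ⟨-, m, hm, g, hgc, hgd, hfg⟩ := (Finset.mem_filter.mp hf).2.1
    exact Finset.mem_biUnion.mpr ⟨m, Finset.mem_range.mpr (Nat.lt_succ_of_le hm),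
      Finset.mem_filter.mpr ⟨hf, g, hgc, hgd, hfg⟩⟩
  -- size of each piece, by the zero-pattern count
  have hTmcard : ∀ m, (Tm m).card ≤ (2 * N * (2 * t) + 1) ^ p m := by
    intro m
    have hinj : Set.InjOn (coeffVector (monomialsDegLE n d)) (Tm m : Set (MvPolynomial (Fin n) ℂ)) := by
      intro f hf g hg hfg
      obtain ⟨e, -, rfl⟩ := hTvec f (Finset.mem_filter.mp hf).1
      obtain ⟨e', -, rfl⟩ := hTvec g (Finset.mem_filter.mp hg).1
      rw [Coeffs.coeffVector_poly, Coeffs.coeffVector_poly] at hfg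
      have : e = e' := funext fun μ => by exact_mod_cast congrFun hfg μ
      rw [this]
    rw [← Finset.card_image_of_injOn hinj]
    refine ZeroPatterns.card_le_of_signVectors_mem_image (G m) (hdeg m) _ ?_ ?_
    · intro c hc μ
      obtain ⟨f, hf, rfl⟩ := Finset.mem_image.mp hc
      obtain ⟨e, he, rfl⟩ := hTvec f (Finset.mem_filter.mp hf).1
      rw [Coeffs.coeffVector_poly]
      rcases he μ with h | h | h <;> simp [h]
    · intro c hc
      obtain ⟨f, hf, rfl⟩ := Finset.mem_image.mp hc
      obtain ⟨g, hgc, hgd, hfg⟩ := (Finset.mem_filter.mp hf).2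
      obtain ⟨y, hy⟩ := hG m g hgd hgc
      exact ⟨y, fun μ => by rw [hy μ, coeffVector_apply, hfg]⟩
  -- the explicit bound
  set Z := (t + 1) * (4 * t * (n + d).choose d + 1) ^ (9376 * (n + t + t + t + 4) ^ 21) with hZ
  have hTZ : T.card ≤ Z := by
    have h1 : T.card ≤ ∑ m ∈ Finset.range (t + 1), (Tm m).card :=
      (Finset.card_le_card hTsub).trans Finset.card_biUnion_le
    refine h1.trans ?_
    have h2 : ∀ m ∈ Finset.range (t + 1), (Tm m).card ≤
        (4 * t * (n + d).choose d + 1) ^ (9376 * (n + t + t + t + 4) ^ 21) := by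
      intro m hm
      have hmt : m ≤ t := Nat.lt_succ_iff.mp (Finset.mem_range.mp hm)
      refine (hTmcard m).trans ?_
      calc (2 * N * (2 * t) + 1) ^ p m ≤ (4 * t * (n + d).choose d + 1) ^ p m := by
            apply Nat.pow_le_pow_left
            rw [hNc]
            have : 2 * (n + d).choose d * (2 * t) = 4 * t * (n + d).choose d := by ring
            omega
        _ ≤ (4 * t * (n + d).choose d + 1) ^ (9376 * (n + t + t + t + 4) ^ 21) := by
            refine Nat.pow_le_pow_right (Nat.succ_pos _) ((hp m).trans ?_)
            apply Nat.mul_le_mul_left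
            apply Nat.pow_le_pow_left
            omega
    refine (Finset.sum_le_card_nsmul _ _ _ h2).trans ?_
    rw [Finset.card_range, smul_eq_mul]
  set B := Z * d + 1 with hB
  have hBdef : hitBoundVNP n d t = B := rfl
  have hB1 : 1 ≤ B := Nat.le_add_left 1 _
  -- the grid `[1, B]^n` inside `ℂ^n`
  let Sg : Finset ℂ := (Finset.Icc 1 B).image (fun k : ℕ => (k : ℂ))
  have hSg_card : Sg.card = B := by
    rw [Finset.card_image_of_injective _ Nat.cast_injective, Nat.card_Icc]; omega
  have hSg_ne : Sg.Nonempty := by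
    rw [← Finset.card_pos, hSg_card]; exact hB1
  let grid : Finset (Fin n → ℂ) := Fintype.piFinset fun _ : Fin n => Sg
  let bad : MvPolynomial (Fin n) ℂ → Finset (Fin n → ℂ) := fun f =>
    grid.filter (fun x => eval x f = 0)
  have hbad : ∀ f ∈ T, (bad f).card * B ≤ d * B ^ n := by
    intro f hf
    obtain ⟨e, -, rfl⟩ := hTvec f hf
    have h0 : Coeffs.poly e ≠ 0 := (Finset.mem_filter.mp hf).2.2
    have := SignSlice.card_zeros_mul_le h0
      (Coeffs.totalDegree_poly_le (HitGen.degree_le_of_mem n d) e) Sg hSg_ne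
    rwa [hSg_card] at this
  let allbad : Finset (Fin n → ℂ) := T.biUnion bad
  have hallbad : allbad.card < grid.card := by
    have hgrid : grid.card = B ^ n := by
      simp [grid, Fintype.card_piFinset, hSg_card]
    rw [hgrid]
    have h1 : allbad.card * B ≤ T.card * (d * B ^ n) := by
      calc allbad.card * B ≤ (∑ f ∈ T, (bad f).card) * B :=
            Nat.mul_le_mul_right _ (Finset.card_biUnion_le)
        _ = ∑ f ∈ T, (bad f).card * B := Finset.sum_mul _ _ _
        _ ≤ ∑ _f ∈ T, d * B ^ n := Finset.sum_le_sum hbad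
        _ = T.card * (d * B ^ n) := by rw [Finset.sum_const, smul_eq_mul]
    have h2 : T.card * (d * B ^ n) ≤ (Z * d) * B ^ n := by
      rw [← mul_assoc]; exact Nat.mul_le_mul_right _ (Nat.mul_le_mul_right _ hTZ)
    have h3 : Z * d < B := by omega
    by_contra hge
    push Not at hge
    have hBn : 0 < B ^ n := pow_pos (by omega) n
    have : B * B ^ n ≤ (Z * d) * B ^ n :=
      calc B * B ^ n ≤ allbad.card * B := by rw [mul_comm]; exact Nat.mul_le_mul_right _ hge
        _ ≤ (Z * d) * B ^ n := h1.trans h2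
    have := Nat.le_of_mul_le_mul_right this hBn
    omega
  obtain ⟨x, hxg, hxa⟩ := Finset.exists_mem_notMem_of_card_lt_card hallbad
  -- read off the integer coordinates
  have hxi : ∀ i, ∃ k : ℕ, (1 ≤ k ∧ k ≤ B) ∧ (k : ℂ) = x i := by
    intro i
    have := Fintype.mem_piFinset.mp hxg i
    obtain ⟨k, hk, hkx⟩ := Finset.mem_image.mp this
    exact ⟨k, Finset.mem_Icc.mp hk, hkx⟩
  choose a ha hax using hxi
  have hxeq : (fun i => (a i : ℂ)) = x := funext hax
  refine ⟨a, fun i => hBdef ▸ ha i, fun f hf hs h0 => ?_⟩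
  rw [hxeq]
  intro hzero
  exact hxa (Finset.mem_biUnion.mpr ⟨f, hTmem f hf hs h0, Finset.mem_filter.mpr ⟨hxg, hzero⟩⟩)

end VNPHit

end Summit.ValiantsHypothesis.ValiantsHypothesis.Theorems.BarrierLever.NaturalProofsSeparateVNP
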